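import Summits.AnomalousDissipation.AnomalousDissipation.Theorems.EnsembleRigidityDefs
import Literature.Analysis.FunctionSpaces.TorusTrigPoly
import Literature.Analysis.FunctionSpaces.TorusFourierModes
import Literature.Analysis.FunctionSpaces.TorusFourierConvolution
import Literature.Analysis.FunctionSpaces.TorusSobolevNormProofs
import Literature.Analysis.FunctionSpaces.TorusHNegOnePairing
import Literature.Analysis.FunctionSpaces.TorusCalculus
import Literature.Analysis.FluidPDE.StokesTorusProofs
import Literature.MathematicalPhysics.QuantumManyBody.PeriodicMaxFormBound

/-!
# Stub `stub_headPinned` of line `Sketch` (crux stmt-AnomalousDissipation-15509)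

Representation content of the low Fourier shells in the symmetry class of the Galloway–Proctor force
`f_GP` (`Theorems/EnsembleRigidityDefs`): a smooth solenoidal mean-zero `G`-symmetric field
band-limited to `|k|² ≤ 1` is a multiple of `f_GP`, and one band-limited to `|k|² ≤ 4` lies in the
head plane `ℝ f_GP ⊕ ℝ g` (`g = lambMode`). The generators of `G` act on the scalar Fourier
coefficients `ûᵢ(k)` by signed coordinate permutations and signs (`mFourierCoeff_comp_signFlip`,
`mFourierCoeff_comp_twistTurn`, the 3-cycle of `PeriodicMaxFormBound`); with transversality,
reality/oddness and `û(0) = 0` the finite linear system on `|k|² ≤ 4` is solved by exact elimination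
(`coeff_formula`, shell dimensions `1, 1, 0, 0`), and Fourier uniqueness concludes.
-/

noncomputable section

-- every `Summit.AnomalousDissipation.AnomalousDissipation.…` name repeats the summit = sub-problem segment (D-0017 layout)
set_option linter.dupNamespace false

namespace Summit.AnomalousDissipation.AnomalousDissipation.Theorems.EnsembleRigidity.GPMeanBoundedFamily

open MeasureTheory Filter Topology UnitAddTorus
open scoped InnerProductSpace
open Literature.Analysis.FunctionSpaces Literature.Analysis.FluidPDE
open Summit.AnomalousDissipation.AnomalousDissipation.Theorems.EnsembleRigidity

namespace StubHeadPinned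

/-- Fourier coefficients under coordinate sign changes `y ↦ (εᵢ yᵢ)ᵢ`, `εᵢ = ±1`:
`𝓕(g ∘ ε)(n) = 𝓕g(ε n)` (the sign change is a measure-preserving involution of `T³` and
`e_{-n}(ε y) = e_{-εn}(y)`). [folklore] -/
theorem mFourierCoeff_comp_signFlip (ε : Fin 3 → ℤ) (hε : ∀ i, ε i = 1 ∨ ε i = -1)
    (g : UnitAddTorus (Fin 3) → ℂ) (n : Fin 3 → ℤ) :
    mFourierCoeff (fun y : UnitAddTorus (Fin 3) => g (fun i => ε i • y i)) n =
      mFourierCoeff g (fun i => ε i * n i) := by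
  have hεsq : ∀ i, ε i * ε i = 1 := fun i => by rcases hε i with h | h <;> simp [h]
  have hmp : MeasurePreserving (fun (y : UnitAddTorus (Fin 3)) (i : Fin 3) => ε i • y i)
      volume volume := by
    refine volume_preserving_pi (f := fun i (x : UnitAddCircle) => ε i • x) fun i => ?_
    rcases hε i with h | h <;> simp only [h, one_zsmul, neg_one_zsmul]
    · exact MeasurePreserving.id volume
    · exact Measure.measurePreserving_neg volume
  have hinv : ∀ y : UnitAddTorus (Fin 3), (fun i => ε i • (fun j => ε j • y j) i) = y := fun y => by
    funext i; simp only [smul_smul, hεsq, one_zsmul]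
  let e : UnitAddTorus (Fin 3) ≃ᵐ UnitAddTorus (Fin 3) :=
    { toFun := fun y i => ε i • y i
      invFun := fun y i => ε i • y i
      left_inv := hinv
      right_inv := hinv
      measurable_toFun := hmp.measurable
      measurable_invFun := hmp.measurable }
  have he : MeasurePreserving e volume volume := hmp
  rw [Torus.mFourierCoeff_eq_integral_volume, Torus.mFourierCoeff_eq_integral_volume,
    ← he.integral_comp']
  refine integral_congr_ae (Eventually.of_forall fun y => ?_)
  show mFourier (-n) (fun i => ε i • y i) • g (fun i => ε i • (fun j => ε j • y j) i) =
    mFourier (-fun i => ε i * n i) y • g y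
  rw [hinv y]
  congr 1
  simp only [mFourier, ContinuousMap.coe_mk, Pi.neg_apply, fourier_apply]
  refine Finset.prod_congr rfl fun i _ => ?_
  rw [smul_smul]
  congr 2
  ring

/-- Fourier coefficients under the twisted half-turn `y ↦ (y₀ + ½, -y₁, -y₂ + ½)`:
`𝓕(g ∘ twistTurn)(n) = e^{πi n₀} e^{-πi n₂} 𝓕g(n₀, -n₁, -n₂)`. [folklore] -/
theorem mFourierCoeff_comp_twistTurn (g : UnitAddTorus (Fin 3) → ℂ) (n : Fin 3 → ℤ) :
    mFourierCoeff (fun y : UnitAddTorus (Fin 3) => g (twistTurn y)) n =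
      (fourier (n 0) halfPeriod * fourier (-(n 2)) halfPeriod) *
        mFourierCoeff g (fun i => (![1, -1, -1] : Fin 3 → ℤ) i * n i) := by
  have hε : ∀ i : Fin 3, (![1, -1, -1] : Fin 3 → ℤ) i = 1 ∨ (![1, -1, -1] : Fin 3 → ℤ) i = -1 := by
    intro i; fin_cases i <;> simp
  have h1 : (fun y : UnitAddTorus (Fin 3) => g (twistTurn y)) = fun y =>
      g ((fun i : Fin 3 => (![1, -1, -1] : Fin 3 → ℤ) i • y i) + ![halfPeriod, 0, halfPeriod]) := by
    funext y
    congr 1; funext i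
    fin_cases i <;> simp [twistTurn]
  rw [h1]
  refine (mFourierCoeff_comp_signFlip _ hε (fun t => g (t + ![halfPeriod, 0, halfPeriod])) n).trans ?_
  rw [Literature.MathematicalPhysics.QuantumManyBody.BoseGas.mFourierCoeff_comp_add_right]
  congr 1
  simp [mFourier, Fin.prod_univ_three]

/-- `e^{πi} = -1` at the half period: `fourier 1 ½ = -1`. [folklore] -/
theorem fourier_one_halfPeriod : fourier 1 halfPeriod = -1 := by
  rw [halfPeriod, fourier_coe_apply, ← Complex.exp_pi_mul_I]
  congr 1; push_cast; ring

/-- `e^{2πi} = 1` at the half period: `fourier 2 ½ = 1`. [folklore] -/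
theorem fourier_two_halfPeriod : fourier 2 halfPeriod = 1 := by
  rw [halfPeriod, fourier_coe_apply, ← Complex.exp_two_pi_mul_I]
  congr 1; push_cast; ring

/-- Fourier coefficients of the sine character `y ↦ Im e_m(y)`: `-i/2` at `m` and `i/2` at `-m`.
[folklore] -/
theorem mFourierCoeff_im_mFourier (m n : Fin 3 → ℤ) :
    mFourierCoeff (fun y : UnitAddTorus (Fin 3) => (((mFourier m y).im : ℝ) : ℂ)) n =
      (if m = n then -(Complex.I / 2) else 0) + (if -m = n then Complex.I / 2 else 0) := by
  have hfun : (fun y : UnitAddTorus (Fin 3) => (((mFourier m y).im : ℝ) : ℂ)) =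
      fun y => ∑ j : Fin 2, mFourier ((![m, -m] : Fin 2 → Fin 3 → ℤ) j) y •
        ((![-(Complex.I / 2), Complex.I / 2] : Fin 2 → ℂ) j) := by
    funext y
    simp only [Fin.sum_univ_two, Matrix.cons_val_zero, Matrix.cons_val_one, smul_eq_mul]
    rw [mFourier_neg]
    generalize mFourier m y = z
    apply Complex.ext
    · simp; ring
    · simp
  rw [hfun, Torus.mFourierCoeff_sum_mFourier_smul]
  simp only [Fin.sum_univ_two, Matrix.cons_val_zero, Matrix.cons_val_one]

/-- Normal forms of rotated / sign-flipped frequency literals. [folklore] -/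
theorem vec_norm (a b c : ℤ) :
    (fun j : Fin 3 => (![a, b, c] : Fin 3 → ℤ) (j + 1)) = ![b, c, a] ∧
    (fun j : Fin 3 => (![a, b, c] : Fin 3 → ℤ) (j + 1 + 1)) = ![c, a, b] ∧
    (fun i : Fin 3 => (![1, -1, -1] : Fin 3 → ℤ) i * (![a, b, c] : Fin 3 → ℤ) i) = ![a, -b, -c] ∧
    (fun j : Fin 3 => (![1, -1, -1] : Fin 3 → ℤ) (j + 1) * (![a, b, c] : Fin 3 → ℤ) (j + 1)) =
      ![-b, -c, a] := by
  refine ⟨?_, ?_, ?_, ?_⟩ <;> funext j <;> fin_cases j <;> simp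

/-- The first component of the head plane fields:
`(c₁ f_GP + c₂ g)₀ = c₁ Im e_{(0,0,1)} + (c₂/2)(Im e_{(0,1,1)} + Im e_{(0,1,-1)})`. [folklore] -/
theorem head_apply_zero (c₁ c₂ : ℝ) (y : UnitAddTorus (Fin 3)) :
    ((((c₁ • gpForce + c₂ • lambMode) y) 0 : ℝ) : ℂ) =
      (c₁ : ℂ) * (((mFourier ![0, 0, 1] y).im : ℝ) : ℂ) + (c₂ : ℂ) / 2 *
        ((((mFourier ![0, 1, 1] y).im : ℝ) : ℂ) + (((mFourier ![0, 1, -1] y).im : ℝ) : ℂ)) := by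
  simp [gpForce, lambMode, Torus.stokesMode_apply, mFourier, Fin.prod_univ_three]
  ring

/-- The head plane fields are covariant under the coordinate 3-cycle:
`(c₁ f_GP + c₂ g)(cycShift y)ᵢ = (c₁ f_GP + c₂ g)(y)ᵢ₊₁`. [folklore] -/
theorem head_cycShift (c₁ c₂ : ℝ) (y : UnitAddTorus (Fin 3)) (i : Fin 3) :
    (c₁ • gpForce + c₂ • lambMode) (cycShift y) i = (c₁ • gpForce + c₂ • lambMode) y (i + 1) := by
  fin_cases i <;>
    simp [gpForce, lambMode, Torus.stokesMode_apply, cycShift, mFourier, Fin.prod_univ_three,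
      Complex.mul_im] <;> ring

set_option maxHeartbeats 1600000 in
-- the 125-case enumeration of the frequency box `[-2, 2]³` below needs about 4× the default budget
/-- **The linear algebra of the low shells.** A table `a : ℤ³ → ℂ` (the coefficients `û₀(k)`)
satisfying the Fourier-side form of the `G`-symmetry (oddness, twisted half-turn covariance of `u₀`
and of `u₁ = u₀ ∘ rot`), transversality `∑ᵢ kᵢ û₀(rotⁱ k) = 0`, `a(0) = 0` and support in `|k|² ≤ 4`
agrees with the first-component coefficients of `-2τ f_GP - 4σ g`, `a(0,0,1) = iτ`, `a(0,1,1) = iσ`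
(exact elimination on the shells `|k|² = 1, 2, 3, 4`, symmetric dimensions `1, 1, 0, 0`). [folklore] -/
theorem coeff_formula (a : (Fin 3 → ℤ) → ℂ) (τ σ : ℝ) (hodd : ∀ k : Fin 3 → ℤ, a (-k) = -a k)
    (ht0 : ∀ k : Fin 3 → ℤ, a k = (fourier (k 0) halfPeriod * fourier (-(k 2)) halfPeriod) *
      a (fun i => (![1, -1, -1] : Fin 3 → ℤ) i * k i))
    (ht1 : ∀ k : Fin 3 → ℤ, a (fun j => k (j + 1)) =
      -((fourier (k 0) halfPeriod * fourier (-(k 2)) halfPeriod) *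
        a (fun j => (![1, -1, -1] : Fin 3 → ℤ) (j + 1) * k (j + 1))))
    (hdiv : ∀ k : Fin 3 → ℤ, (k 0 : ℂ) * a k + (k 1 : ℂ) * a (fun j => k (j + 1)) +
      (k 2 : ℂ) * a (fun j => k (j + 1 + 1)) = 0)
    (hmean : a 0 = 0) (hout : ∀ k, k ∉ Torus.freqBall 2 → a k = 0)
    (hτ : a ![0, 0, 1] = (τ : ℂ) * Complex.I) (hσ : a ![0, 1, 1] = (σ : ℂ) * Complex.I)
    (k : Fin 3 → ℤ) :
    a k = mFourierCoeff (fun y : UnitAddTorus (Fin 3) =>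
      (((((-2 * τ) • gpForce + (-4 * σ) • lambMode) y) 0 : ℝ) : ℂ)) k := by
  -- ## instances of the relations on the ball `|k|² ≤ 4`, normalised
  have q01 := ht0 ![1, 0, 0]; have q02 := hodd ![1, 0, 0]; have q03 := ht0 ![0, 1, 0]
  have q04 := hodd ![0, 1, 0]; have q05 := hodd ![0, 0, 1]; have q06 := ht1 ![0, 1, 1]
  have q07 := hodd ![1, 1, 0]; have q08 := ht0 ![1, 1, 0]; have q09 := hodd ![1, -1, 0]
  have q10 := ht0 ![1, 0, 1]; have q11 := ht1 ![1, 1, 0]; have q12 := hodd ![1, 0, -1]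
  have q13 := hodd ![1, 0, 1]; have q14 := ht1 ![1, 0, 1]; have q15 := hodd ![0, -1, 1]
  have q16 := hodd ![0, 1, 1]; have q17 := ht0 ![1, 1, 1]; have q18 := hodd ![1, 1, 1]
  have q19 := hodd ![1, -1, -1]; have q20 := ht0 ![1, 1, -1]; have q21 := ht1 ![1, 1, 1]
  have q22 := hodd ![-1, -1, 1]; have q23 := hodd ![1, -1, 1]; have q24 := hdiv ![1, 1, 1]
  have q25 := hdiv ![2, 0, 0]; have q26 := hodd ![2, 0, 0]; have q27 := ht0 ![0, 2, 0]
  have q28 := hodd ![0, 2, 0]; have q29 := ht0 ![0, 0, 2]; have q30 := hodd ![0, 0, 2]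
  simp only [Matrix.cons_val_zero, Matrix.cons_val_one, Matrix.cons_val_two, Matrix.head_cons,
    Matrix.tail_cons, Matrix.neg_cons, Matrix.neg_empty, neg_zero, neg_neg, vec_norm, fourier_zero,
    fourier_one_halfPeriod, fourier_two_halfPeriod, fourier_neg, map_neg, map_one, Int.cast_zero,
    Int.cast_one, Int.cast_ofNat]
    at q01 q02 q03 q04 q05 q06 q07 q08 q09 q10 q11 q12 q13 q14 q15 q16 q17 q18 q19 q20 q21 q22 q23 q24 q25 q26 q27 q28 q29 q30
  -- ## the table of `a(k)`, `|k|² ≤ 4` (besides `a(0,0,±1) = ±iτ`, `a(0,±1,±1)`)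
  have e100 : a ![1, 0, 0] = 0 := by linear_combination q01 / 2
  have em100 : a ![-1, 0, 0] = 0 := by linear_combination q02 - e100
  have e010 : a ![0, 1, 0] = 0 := by linear_combination (q03 + q04) / 2
  have e0m10 : a ![0, -1, 0] = 0 := by linear_combination q04 - e010
  have e110 : a ![1, 1, 0] = 0 := by linear_combination (q06 + q07) / 2
  have e1m10 : a ![1, -1, 0] = 0 := by linear_combination q08 - e110
  have em1m10 : a ![-1, -1, 0] = 0 := by linear_combination q07 - e110
  have em110 : a ![-1, 1, 0] = 0 := by linear_combination q09 - e1m10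
  have e101 : a ![1, 0, 1] = 0 := by linear_combination (q10 + q11 + q12) / 2
  have e10m1 : a ![1, 0, -1] = 0 := by linear_combination e101 - q10
  have em101 : a ![-1, 0, 1] = 0 := by linear_combination q12 - e10m1
  have em10m1 : a ![-1, 0, -1] = 0 := by linear_combination q13 - e101
  have e0m11 : a ![0, -1, 1] = -a ![0, 1, 1] := by linear_combination q14
  have e01m1 : a ![0, 1, -1] = a ![0, 1, 1] := by linear_combination q15 - q14
  have e111 : a ![1, 1, 1] = 0 := by linear_combination q24 / 3
  have e1m1m1 : a ![1, -1, -1] = 0 := by linear_combination e111 - q17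
  have em1m1m1 : a ![-1, -1, -1] = 0 := by linear_combination q18 - e111
  have em111 : a ![-1, 1, 1] = 0 := by linear_combination q19 - e1m1m1
  have em1m11 : a ![-1, -1, 1] = 0 := by linear_combination q21 - e111
  have e11m1 : a ![1, 1, -1] = 0 := by linear_combination q22 - em1m11
  have e1m11 : a ![1, -1, 1] = 0 := by linear_combination e11m1 - q20
  have em11m1 : a ![-1, 1, -1] = 0 := by linear_combination q23 - e1m11
  have e200 : a ![2, 0, 0] = 0 := by linear_combination q25 / 2
  have em200 : a ![-2, 0, 0] = 0 := by linear_combination q26 - e200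
  have e020 : a ![0, 2, 0] = 0 := by linear_combination (q27 + q28) / 2
  have e0m20 : a ![0, -2, 0] = 0 := by linear_combination q28 - e020
  have e002 : a ![0, 0, 2] = 0 := by linear_combination (q29 + q30) / 2
  have e00m2 : a ![0, 0, -2] = 0 := by linear_combination q30 - e002
  have e000 : a ![0, 0, 0] = 0 := by
    rw [show (![0, 0, 0] : Fin 3 → ℤ) = 0 from by funext i; fin_cases i <;> rfl]; exact hmean
  -- ## the coefficients of `-2τ f_GP - 4σ g`
  have hF : ∀ m : Fin 3 → ℤ,
      Integrable (fun y : UnitAddTorus (Fin 3) => (((mFourier m y).im : ℝ) : ℂ)) volume := fun m =>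
    (Complex.continuous_ofReal.comp
      (Complex.continuous_im.comp (mFourier m).continuous)).integrable_unitAddTorus
  have hfun : (fun y : UnitAddTorus (Fin 3) =>
      (((((-2 * τ) • gpForce + (-4 * σ) • lambMode) y) 0 : ℝ) : ℂ)) =
      ((-2 * τ : ℝ) : ℂ) • (fun y => (((mFourier ![0, 0, 1] y).im : ℝ) : ℂ)) +
        (((-4 * σ : ℝ) : ℂ) / 2) • ((fun y => (((mFourier ![0, 1, 1] y).im : ℝ) : ℂ)) +
          fun y => (((mFourier ![0, 1, -1] y).im : ℝ) : ℂ)) := by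
    funext y
    simp only [Pi.add_apply, Pi.smul_apply, smul_eq_mul]
    exact head_apply_zero _ _ y
  rw [hfun, Torus.mFourierCoeff_add ((hF _).smul _) (((hF _).add (hF _)).smul _),
    Torus.mFourierCoeff_const_smul, Torus.mFourierCoeff_const_smul,
    Torus.mFourierCoeff_add (hF _) (hF _), mFourierCoeff_im_mFourier, mFourierCoeff_im_mFourier,
    mFourierCoeff_im_mFourier]
  simp only [smul_eq_mul]
  by_cases hk : k ∈ Torus.freqBall 2
  · -- ## inside the ball: enumerate the box `[-2, 2]³`
    have hk' := Torus.mem_freqBall.1 hk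
    obtain ⟨a, b, c, rfl⟩ : ∃ a b c : ℤ, k = ![a, b, c] :=
      ⟨k 0, k 1, k 2, by funext i; fin_cases i <;> rfl⟩
    simp only [Torus.freqNormSq, Fin.sum_univ_three, Matrix.cons_val_zero, Matrix.cons_val_one,
      Matrix.cons_val_two, Matrix.head_cons, Matrix.tail_cons, Nat.cast_ofNat] at hk'
    have hZ : a * a + b * b + c * c ≤ 4 := by
      have h : ((a * a + b * b + c * c : ℤ) : ℝ) ≤ 4 := by push_cast; nlinarith [hk']
      exact_mod_cast h
    obtain ⟨ha1, ha2⟩ : -2 ≤ a ∧ a ≤ 2 := by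
      constructor <;> nlinarith [mul_self_nonneg b, mul_self_nonneg c]
    obtain ⟨hb1, hb2⟩ : -2 ≤ b ∧ b ≤ 2 := by
      constructor <;> nlinarith [mul_self_nonneg a, mul_self_nonneg c]
    obtain ⟨hc1, hc2⟩ : -2 ≤ c ∧ c ≤ 2 := by
      constructor <;> nlinarith [mul_self_nonneg a, mul_self_nonneg b]
    interval_cases a <;> interval_cases b <;> interval_cases c <;>
      simp only [e000, e100, em100, e010, e0m10, hτ, q05, e110, e1m10, em1m10, em110, e101, e10m1,
        em101, em10m1, hσ, e0m11, e01m1, q16, e111, e1m1m1, em1m1m1, em111, em1m11, e11m1, e1m11,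
        em11m1, e200, em200, e020, e0m20, e002, e00m2, Matrix.vecCons_inj, Matrix.neg_cons,
        Matrix.neg_empty, neg_zero, neg_neg, Int.reduceEq, and_true, and_false, if_true, if_false,
        add_zero, zero_add, mul_zero] <;>
      first
      | (exfalso; omega)
      | (push_cast; ring)
  · -- ## outside the ball both sides vanish (the six modes lie in the ball)
    have hne : ∀ m : Fin 3 → ℤ, Torus.freqNormSq m ≤ 4 → (m = k ↔ False) := fun m hm =>
      ⟨fun h => hk (h ▸ Torus.mem_freqBall.2 (by norm_num [hm])), False.elim⟩
    simp (disch := norm_num [Torus.freqNormSq, Fin.sum_univ_three, Matrix.cons_val_two,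
        Matrix.tail_cons, Matrix.head_cons]) only [hout k hk, hne, Matrix.neg_cons, Matrix.neg_empty,
      neg_zero, if_false, add_zero, mul_zero]

/-- **Shell bookkeeping** for `|k|² ≤ 4`: a smooth solenoidal mean-zero `G`-symmetric field
band-limited to `|k|² ≤ 4` is `c₁ f_GP + c₂ g` with `c₁ = -2 Im û₀(0,0,1)`, `c₂ = -4 Im û₀(0,1,1)`.
[folklore] -/
theorem pinned_two {u : UnitAddTorus (Fin 3) → EuclideanSpace ℝ (Fin 3)} (hs : Torus.IsSmooth u)
    (hdiv : Torus.IsDivFree u) (hmean : Torus.HasZeroMean u) (htr : Torus.fourierTruncate 2 u = u)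
    (hsym : IsGPSymmetric u) :
    u = (-2 * (mFourierCoeff (fun y => ((u y 0 : ℝ) : ℂ)) ![0, 0, 1]).im) • gpForce +
        (-4 * (mFourierCoeff (fun y => ((u y 0 : ℝ) : ℂ)) ![0, 1, 1]).im) • lambMode := by
  obtain ⟨hcyc, hodd, htw⟩ := hsym
  obtain ⟨A, hA⟩ : ∃ A : Fin 3 → (Fin 3 → ℤ) → ℂ,
      ∀ i k, mFourierCoeff (fun y => ((u y i : ℝ) : ℂ)) k = A i k := ⟨_, fun _ _ => rfl⟩
  have hcont : Continuous u := hs.continuous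
  have hint : Integrable u volume := hs.integrable
  -- ## the linear relations among the coefficients `A i k = ûᵢ(k)`
  have hodd' : ∀ k, A 0 (-k) = -A 0 k := by
    intro k
    have h1 : (fun y => ((u (fun i => (-1 : ℤ) • y i) 0 : ℝ) : ℂ)) = -fun y => ((u y 0 : ℝ) : ℂ) := by
      funext y; simp only [neg_one_zsmul, Pi.neg_apply]; rw [← Complex.ofReal_neg, ← hodd y 0]; rfl
    have h2 := mFourierCoeff_comp_signFlip (fun _ => -1) (fun _ => Or.inr rfl)
      (fun y => ((u y 0 : ℝ) : ℂ)) k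
    rw [h1, Torus.mFourierCoeff_neg, hA, hA] at h2
    simp only [neg_one_mul] at h2
    exact h2.symm
  have him : ∀ k, A 0 k = (((A 0 k).im : ℝ) : ℂ) * Complex.I := fun k => by
    have h := congrArg Complex.re
      ((((hA 0 (-k)).symm.trans (Torus.mFourierCoeff_ofReal_comp _ k)).symm.trans (hodd' k)))
    simp only [hA, Complex.conj_re, Complex.neg_re] at h
    refine Complex.ext ?_ (by simp)
    simpa using (by linarith : (A 0 k).re = 0)
  have hc : ∀ (i : Fin 3) (k : Fin 3 → ℤ), A (i + 1) k = A i (fun j => k (j + 1)) := by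
    intro i k
    rw [← hA, ← hA]
    refine Eq.trans ?_ (Literature.MathematicalPhysics.QuantumManyBody.BoseGas.mFourierCoeff_comp_compPerm
      (fun y => ((u y i : ℝ) : ℂ)) (Equiv.addRight (1 : Fin 3)) k)
    congr 1; funext y
    exact congrArg (fun r : ℝ => (r : ℂ)) (hcyc y i).symm
  have hc1 : ∀ k, A 1 k = A 0 (fun j => k (j + 1)) := fun k => hc 0 k
  have hc2 : ∀ k, A 2 k = A 1 (fun j => k (j + 1)) := fun k => hc 1 k
  have ht : ∀ (i : Fin 3) (s : ℂ), (∀ y, u (twistTurn y) i = s * u y i) → ∀ k : Fin 3 → ℤ,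
      s * A i k = (fourier (k 0) halfPeriod * fourier (-(k 2)) halfPeriod) *
        A i (fun j => (![1, -1, -1] : Fin 3 → ℤ) j * k j) := by
    intro i s hsi k
    rw [← hA, ← hA, ← mFourierCoeff_comp_twistTurn, ← smul_eq_mul, ← Torus.mFourierCoeff_const_smul]
    congr 1; funext y
    simp only [Pi.smul_apply, smul_eq_mul, hsi y]
  have ht0 : ∀ k : Fin 3 → ℤ, A 0 k = (fourier (k 0) halfPeriod * fourier (-(k 2)) halfPeriod) *
      A 0 (fun j => (![1, -1, -1] : Fin 3 → ℤ) j * k j) := fun k => by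
    simpa using ht 0 1 (fun y => by rw [(htw y).1, one_mul]) k
  have ht1 : ∀ k : Fin 3 → ℤ, A 0 (fun j => k (j + 1)) =
      -((fourier (k 0) halfPeriod * fourier (-(k 2)) halfPeriod) *
        A 0 (fun j => (![1, -1, -1] : Fin 3 → ℤ) (j + 1) * k (j + 1))) := fun k => by
    have h := ht 1 (-1) (fun y => by rw [(htw y).2.1, neg_one_mul, Complex.ofReal_neg]) k
    simp only [hc1, neg_one_mul] at h
    rw [← h, neg_neg]
  have hdiv' : ∀ k : Fin 3 → ℤ, (k 0 : ℂ) * A 0 k + (k 1 : ℂ) * A 0 (fun j => k (j + 1)) +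
      (k 2 : ℂ) * A 0 (fun j => k (j + 1 + 1)) = 0 := fun k => by
    simpa only [Fin.sum_univ_three, Torus.mFourierCoeff_complexify_apply hint, hA, hc1, hc2] using
      hdiv.sum_mul_mFourierCoeff_eq_zero hs k
  have hmean' : A 0 0 = 0 := by
    simpa [Torus.mFourierCoeff_complexify_apply hint, hA] using
      congrArg (fun w => w 0) (Torus.mFourierCoeff_complexify_zero_of_hasZeroMean hint hmean)
  have hout : ∀ k, k ∉ Torus.freqBall 2 → A 0 k = 0 := by
    intro k hk
    have h := Torus.mFourierCoeff_fourierTruncate hint 2 k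
    rw [htr, if_neg hk] at h
    simpa [Torus.mFourierCoeff_complexify_apply hint, hA] using congrArg (fun w => w 0) h
  -- ## the two free parameters and the pinned coefficients
  obtain ⟨τ, hτ⟩ : ∃ τ : ℝ, A 0 ![0, 0, 1] = (τ : ℂ) * Complex.I := ⟨_, him _⟩
  obtain ⟨σ, hσ⟩ : ∃ σ : ℝ, A 0 ![0, 1, 1] = (σ : ℂ) * Complex.I := ⟨_, him _⟩
  have hτ' : (mFourierCoeff (fun y => ((u y 0 : ℝ) : ℂ)) ![0, 0, 1]).im = τ := by rw [hA, hτ]; simp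
  have hσ' : (mFourierCoeff (fun y => ((u y 0 : ℝ) : ℂ)) ![0, 1, 1]).im = σ := by rw [hA, hσ]; simp
  rw [hτ', hσ']
  have key := coeff_formula (A 0) τ σ hodd' ht0 ht1 hdiv' hmean' hout hτ hσ
  -- ## assembly: component `0` by Fourier uniqueness, components `1, 2` by the cyclic covariance
  have hvc : Continuous fun y : UnitAddTorus (Fin 3) =>
      ((((-2 * τ) • gpForce + (-4 * σ) • lambMode) y 0 : ℝ) : ℂ) := by
    simp only [head_apply_zero]; fun_prop
  have h0 := Torus.eq_of_forall_mFourierCoeff_eq (by fun_prop) hvc fun k => (hA 0 k).trans (key k)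
  have hy0 : ∀ z, u z 0 = ((-2 * τ) • gpForce + (-4 * σ) • lambMode) z 0 := fun z => by
    exact_mod_cast congr_fun h0 z
  funext y
  ext i
  fin_cases i
  · exact hy0 y
  · calc u y 1 = u (cycShift y) 0 := (hcyc y 0).symm
      _ = ((-2 * τ) • gpForce + (-4 * σ) • lambMode) (cycShift y) 0 := hy0 _
      _ = ((-2 * τ) • gpForce + (-4 * σ) • lambMode) y 1 := head_cycShift _ _ y 0
  · calc u y 2 = u (cycShift (cycShift y)) 0 := ((hcyc _ 0).trans (hcyc y 1)).symm
      _ = ((-2 * τ) • gpForce + (-4 * σ) • lambMode) (cycShift (cycShift y)) 0 := hy0 _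
      _ = ((-2 * τ) • gpForce + (-4 * σ) • lambMode) y 2 :=
        (head_cycShift _ _ _ 0).trans (head_cycShift _ _ y 1)

end StubHeadPinned

/-- **S4 `stub_headPinned`** (line `Sketch` of crux stmt-AnomalousDissipation-15509). Representation
content of the low shells in the symmetry class of the Galloway–Proctor force: a smooth solenoidal
mean-zero `G`-symmetric field band-limited to `|k|² ≤ 1` is a multiple of `f_GP`, and one band-limited
to `|k|² ≤ 4` lies in the head plane `ℝ f_GP ⊕ ℝ g` (`dim Fix(G) ∩ E_m = 1, 1, 0, 0`, `m = 1…4`):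
the generators act on Fourier coefficients by signed coordinate permutations and signs, which pins
every coefficient with `|k|² ≤ 4` to `Im û₀(0,0,1)`, `Im û₀(0,1,1)` (`coeff_formula`). [folklore] -/
theorem stub_headPinned :
    (∀ u : UnitAddTorus (Fin 3) → EuclideanSpace ℝ (Fin 3), Torus.IsSmooth u → Torus.IsDivFree u →
        Torus.HasZeroMean u → Torus.fourierTruncate 1 u = u → IsGPSymmetric u →
        ∃ c : ℝ, u = c • gpForce) ∧
    (∀ u : UnitAddTorus (Fin 3) → EuclideanSpace ℝ (Fin 3), Torus.IsSmooth u → Torus.IsDivFree u →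
        Torus.HasZeroMean u → Torus.fourierTruncate 2 u = u → IsGPSymmetric u →
        ∃ c₁ c₂ : ℝ, u = c₁ • gpForce + c₂ • lambMode) := by
  refine ⟨fun u hs hdiv hmean htr hsym => ?_,
    fun u hs hdiv hmean htr hsym => ⟨_, _, StubHeadPinned.pinned_two hs hdiv hmean htr hsym⟩⟩
  -- band-limited to `|k|² ≤ 1`: then band-limited to `|k|² ≤ 4`, and `û₀(0,1,1) = 0`
  have hint : Integrable u volume := hs.integrable
  have hcoef : ∀ k, k ∉ Torus.freqBall 1 → mFourierCoeff (EuclideanSpace.complexify ∘ u) k = 0 := by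
    intro k hk
    have h := Torus.mFourierCoeff_fourierTruncate hint 1 k
    rwa [htr, if_neg hk] at h
  have htr2 : Torus.fourierTruncate 2 u = u := by
    refine Torus.fourierTruncate_eq_self hs.continuous fun k hk => hcoef k (Torus.not_mem_freqBall.2 ?_)
    norm_num at hk ⊢
    linarith
  have h011 : (mFourierCoeff (fun y => ((u y 0 : ℝ) : ℂ)) ![0, 1, 1]).im = 0 := by
    have hk : (![0, 1, 1] : Fin 3 → ℤ) ∉ Torus.freqBall 1 := Torus.not_mem_freqBall.2 (by
      norm_num [Torus.freqNormSq, Fin.sum_univ_three, Matrix.cons_val_two, Matrix.tail_cons,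
        Matrix.head_cons])
    rw [← Torus.mFourierCoeff_complexify_apply hint, hcoef _ hk]
    rfl
  have heq := StubHeadPinned.pinned_two hs hdiv hmean htr2 hsym
  rw [h011, mul_zero, zero_smul, add_zero] at heq
  exact ⟨_, heq⟩

end Summit.AnomalousDissipation.AnomalousDissipation.Theorems.EnsembleRigidity.GPMeanBoundedFamily

end
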